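import Summits.QuantumFields.BalabanUV.Beta.FP.TorusStepInsertionSymTwo

/-!
# `BalabanUV.Beta.FP.TorusStepInsertionSymTwoStep` — road «FP» for binder row D1, ROUTE T, (β1) RE-BASING (ROW RULING R-D1-g52-1 (3)(c) «→ leaf-02: sym twins of
# R-5∕R-6 …»), PART 2 of the R-6 twin: **THE (0.4)-SYMMETRISED ONE-STEP SECOND-ORDER BI-JET `stepIns₂₂Sym w w′` ACTS ON PERIODIC 1-FORMS AS an1's (0.4)-SYMMETRISED
# SECOND-ORDER KERNEL `symVh2KerAt` AT THE CENTRED ROOT, PAIR-SYMMETRISED, AT (the form, the periodic lifts of the two weights)** — R-6 §3 VERBATIM under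
# `vh2KerAt (toSite r) ↦ symVh2KerAt (ctr (d+1) Lc)`, `stepIns₂₂ M Lc r ↦ stepIns₂₂Sym M Lc`

WHY.  PART 1 (`FP/TorusStepInsertionSymTwo`) types the bookkeeping def `stepIns₂₂Sym` and the per-pair action `sum_perF_dper_symPair_mul_periodic`; this file sums it
against the two bond weights — the junction line the sym pass of R-8 `TorusCompositeInsertionPeriodicTwo` (order-2 composite induction over leaf-06's `compRowsSym`)
reads BY NAME, exactly as R-8 reads R-6's `sum_stepIns₂₂_mul_periodic`.

WHAT (generic `d`; box `M`, blocking `Lc`, `T = fine Lc M`; centred root, `hc : ctrOff (d+1) Lc ∈ box (d+1) Lc`; `B` a `T`-periodic real 1-form; `x ∈ pbox M`, `κ₀`).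
* §1 one kernel-generic engine — a PRIVATE verbatim copy of R-6 §1 `sum_mul_tsum_translate_eq_tsum_lift` (a torus bond weight summed over the copies of its bonds =
  the lattice sum against its periodic lift; DISCLOSED as in PART 1: R-6's module has no hub olean at the time of writing, journal INFRA-1 l.56207).
* §2 **`sum_stepIns₂₂Sym_mul_periodic_eq_sum_bonds`** (unfold `stepIns₂₂Sym`, PART 1 §4 per pair of bonds) and **`sum_stepIns₂₂Sym_mul_periodic`**:
  `Σ_q stepIns₂₂Sym M Lc w w′ (x, κ₀) q · B q.2 q.1
   = Σ'_u Σ_κ (Σ'_{u′} Σ_{κ′} (Σ'_z Σ_l ½ (symVh2KerAt (ctr (d+1) Lc) Lc κ₀ x (l,z) (κ,u) (κ′,u′) + symVh2KerAt (ctr (d+1) Lc) Lc κ₀ x (l,z) (κ′,u′) (κ,u)) · B l z) · w′ (wrapPt T u′, κ′)) · w (wrapPt T u, κ)`;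
  every sum finite (an1's `symVh2Tab_eq_zero₁∕₂∕₃`: all three bonds in `Near Lc x`).
NOT HERE: the order-2 composite induction (R-8's sym pass); the sym (COV-2) one-step law; `stepIns₂₂Sym_comm` ∕ bilinearity; any chart; any estimate.

[folklore] finite sums + finitely supported `tsum` re-indexing BY NAME over OUR bookkeeping objects (`stepIns₂₂Sym`, `perF ∕ dper`, `coarsePt ∕ wrapPt ∕ nearBox`) and
an1's typed tables (`symVh2KerAt`); no `def`, no `def … : Prop`, nothing cited, 0 sorry, default heartbeats.  Nothing of the dictionary ∕ Bałaban's non-linear averages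
asserted beyond their typed linearisations (the (β1) presentation is the ROW's ruling R-D1-g52-1, quoted, not adjudicated here); NO chart fixed; the (C1) TABLES,
the seven letters, `hH ∕ hQ` untouched.

HONEST DEPENDENCY (page 1, mandatory): continuum YM on T⁴ ⇐ BetaPertH ∧ nine spine estimates (0/9 proved); BetaPertH ⇐ (D1) ∧ (D4) ∧ CAP+tail;
G-an2-4 gates asym, D1 and NE2/3/4.  HONEST FRAMING (cell contract, verbatim): «discharging `BetaPertH` makes Bałaban's UV stability UNCONDITIONAL —
a real constructive-QFT result; it is NOT the continuum limit and NOT the Clay problem.»  ABSOLUTE RULE (cell charter, verbatim): «No internally-minted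
statement may enter as a cited fact. Every hypothesis is either kernel-proved in this package or a verbatim quotation of a PUBLISHED theorem with page
reference. The manuscript(s) under audit are NOT citable for their own disputed steps — they are the thing under adjudication; programme-internal
(2001/route/tribunal) claims are never citable.»  0 estimates; 0∕4 row-D1 binders (hW, hR, D1Tel, D1Rep); NOT (T-ID), NOT (C1), NOT SDF, NOT D1,
NOT BetaPertH, NOT continuum, NOT Clay.  D1 formalisation swarm LEAF PROVER 02 (b2b-balaban-beta-d1-formalise-leaf-02 gen 31 ∕ gen 32), 2026-08-24.  No existing file touched.
-/

noncomputable section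

open scoped BigOperators

namespace Summit.QuantumFields.BalabanUV.Beta.FP.TorusStepInsertionSymTwoStep

open Matrix Finset
open Literature.MathematicalPhysics.QuantumFieldTheory
open Literature.MathematicalPhysics.QuantumFieldTheory.Balaban1983to89
open Literature.MathematicalPhysics.QuantumFieldTheory.Balaban1983to89.Beta
open B5Prop11Plancherel (fine)
open B6Lemma24Torus (pbox mem_pbox wrap)
open B4TorusKernel.MultiPeriod (translate translate_apply translate_injective)
open Summit.QuantumFields.BalabanUV.Beta.GAN24.DirichletExhaustionPeriodise (one_le_M)
open ExpKernelCalculus (MKer)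
open AffineAveraging (Site Form1 box toSite)
open AveragingContours (off blk)
open AveragingContoursRooted (ctr ctrOff)
open AveragingHessianKernels (Bond Near)
open OneStepResolventKernel (Fib)
open Summit.QuantumFields.BalabanUV.Beta.SymAveragingMixedJetTables (symVh2KerAt symVh₂SAt)
open Summit.QuantumFields.BalabanUV.Beta.GAN24.KernelPeriodisation (wrap_translate)
open Summit.QuantumFields.BalabanUV.Beta.FP.KernelPeriodisationFib (Idx perF perF_apply)
open Summit.QuantumFields.BalabanUV.Beta.FP.KernelPeriodisationFibLoc (dper)
open Summit.QuantumFields.BalabanUV.Beta.FP.KernelPeriodisationFibTrace (tsum_sites_eq_sum_tsum)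
open Summit.QuantumFields.BalabanUV.Beta.FP.TorusGaugeCovariance (nearBox mem_nearBox)
open Summit.QuantumFields.BalabanUV.Beta.FP.TorusGaugeCovariancePairing (wrapPt wrapPt_coe wrapPt_of_mem)
open Summit.QuantumFields.BalabanUV.Beta.FP.TorusGaugeCovarianceCoarse (coarsePt coarsePt_coe)
open Summit.QuantumFields.BalabanUV.Beta.FP.TorusStepInsertionSymTwo (stepIns₂₂Sym symm_symVh2KerAt_eq_zero_of_not_mem tsum_symm_symVh2KerAt_mul_eq_zero_of_not_mem
  summable_sum_symm_symVh2KerAt_mul sum_perF_dper_symPair_mul_periodic)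

variable {d : ℕ}

/-! ## §1 One engine (a PRIVATE verbatim copy of R-6 `FP/TorusStepInsertionPeriodicTwo` §1 — kernel-generic; see the header) -/

section Engines

variable (M : Fin (d + 1) → ℕ) [∀ μ, NeZero (M μ)]

/-- [folklore] (private copy of R-6 §1, verbatim) **`sum_mul_tsum_translate_eq_tsum_lift` — A TORUS BOND WEIGHT SUMMED OVER THE COPIES OF ITS BONDS IS THE LATTICE SUM AGAINST ITS PERIODIC LIFT**:
for `F κ u` vanishing off a finite set in `u`, `Σ_b w b · Σ'_m F b.2 (b.1 + M∘m) = Σ'_u Σ_κ F κ u · w (wrapPt M u, κ)` (box × period lattice = lattice,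
`tsum_sites_eq_sum_tsum`; the lift reads the weight at the box representative, `wrap_translate`). -/
private theorem sum_mul_tsum_translate_eq_tsum_lift (F : Fin (d + 1) → Site (d + 1) → ℝ) (S : Finset (Site (d + 1)))
    (hF : ∀ (κ : Fin (d + 1)), ∀ u ∉ S, F κ u = 0) (w : ↥(pbox M) × Fin (d + 1) → ℝ) :
    ∑ b : ↥(pbox M) × Fin (d + 1), w b * ∑' m : Site (d + 1), F b.2 (translate M (b.1 : Site (d + 1)) m)
      = ∑' u : Site (d + 1), ∑ κ : Fin (d + 1), F κ u * w (wrapPt M u, κ) := by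
  have hS : Summable fun u : Site (d + 1) => ∑ κ : Fin (d + 1), F κ u * w (wrapPt M u, κ) :=
    summable_of_ne_finset_zero (s := S) fun u hu => Finset.sum_eq_zero fun κ _ => by rw [hF κ u hu, zero_mul]
  rw [tsum_sites_eq_sum_tsum M hS, Fintype.sum_prod_type]
  refine Finset.sum_congr rfl fun y _ => ?_
  have hwrap : ∀ (m : Site (d + 1)) (κ : Fin (d + 1)), w (wrapPt M (translate M (y : Site (d + 1)) m), κ) = w (y, κ) := fun m κ => by
    congr 2
    exact Subtype.ext (wrap_translate M y.2 m)
  classical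
  obtain ⟨Fm, hFm⟩ : ∃ F : Finset (Site (d + 1)), ∀ m ∉ F, translate M (y : Site (d + 1)) m ∉ S :=
    ⟨(S).preimage (fun m => translate M (y : Site (d + 1)) m) (translate_injective (one_le_M M) (y : Site (d + 1))).injOn,
      fun m hm hh => hm (Finset.mem_preimage.2 hh)⟩
  have hfin : ∀ κ : Fin (d + 1), ∑' m : Site (d + 1), F κ (translate M (y : Site (d + 1)) m) = ∑ m ∈ Fm, F κ (translate M (y : Site (d + 1)) m) :=
    fun κ => tsum_eq_sum fun m hm => hF κ _ (hFm m hm)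
  calc ∑ κ : Fin (d + 1), w (y, κ) * ∑' m : Site (d + 1), F κ (translate M (y : Site (d + 1)) m)
      = ∑ κ : Fin (d + 1), ∑ m ∈ Fm, F κ (translate M (y : Site (d + 1)) m) * w (y, κ) := by
        refine Finset.sum_congr rfl fun κ _ => ?_
        rw [hfin, mul_comm, Finset.sum_mul]
    _ = ∑ m ∈ Fm, ∑ κ : Fin (d + 1), F κ (translate M (y : Site (d + 1)) m) * w (y, κ) := Finset.sum_comm
    _ = ∑' m : Site (d + 1), ∑ κ : Fin (d + 1), F κ (translate M (y : Site (d + 1)) m) * w (y, κ) :=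
        (tsum_eq_sum fun m hm => Finset.sum_eq_zero fun κ _ => by rw [hF κ _ (hFm m hm), zero_mul]).symm
    _ = ∑' m : Site (d + 1), ∑ κ : Fin (d + 1), F κ (translate M (y : Site (d + 1)) m) * w (wrapPt M (translate M (y : Site (d + 1)) m), κ) := by
        simp only [hwrap]

end Engines

section Step

variable (M : Fin (d + 1) → ℕ) [∀ μ, NeZero (M μ)] (Lc : ℕ) [NeZero Lc]

/-- [folklore] **`sum_stepIns₂₂Sym_mul_periodic_eq_sum_bonds` — THE (0.4)-SYMMETRISED ONE-STEP SECOND-ORDER BI-JET ACTS ON PERIODIC FORMS AS an1's (0.4)-SYMMETRISED KERNEL,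
PAIR OF BONDS BY PAIR OF BONDS** (unfold `stepIns₂₂Sym`, PART 1 §4 per pair of bonds; twin of R-6's `sum_stepIns₂₂_mul_periodic_eq_sum_bonds`). -/
theorem sum_stepIns₂₂Sym_mul_periodic_eq_sum_bonds (hc : ctrOff (d + 1) Lc ∈ box (d + 1) Lc) (w w' : ↥(pbox (fine Lc M)) × Fin (d + 1) → ℝ) (B : Form1 (d + 1) ℝ)
    (hB : ∀ (l : Fin (d + 1)) (y m : Site (d + 1)), B l (translate (fine Lc M) y m) = B l y) (x : ↥(pbox M)) (κ₀ : Fin (d + 1)) :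
    ∑ q : ↥(pbox (fine Lc M)) × Fin (d + 1), stepIns₂₂Sym M Lc w w' (x, κ₀) q * B q.2 (q.1 : Site (d + 1))
      = ∑ b : ↥(pbox (fine Lc M)) × Fin (d + 1), ∑ b' : ↥(pbox (fine Lc M)) × Fin (d + 1), (w b * w' b') *
          ∑' m : Site (d + 1), ∑' n : Site (d + 1), ∑' z : Site (d + 1), ∑ l : Fin (d + 1),
            (1 / 2 : ℝ) * (symVh2KerAt (ctr (d + 1) Lc) Lc κ₀ (x : Site (d + 1)) (l, z) (b.2, translate (fine Lc M) (b.1 : Site (d + 1)) m) (b'.2, translate (fine Lc M) (b'.1 : Site (d + 1)) n)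
              + symVh2KerAt (ctr (d + 1) Lc) Lc κ₀ (x : Site (d + 1)) (l, z) (b'.2, translate (fine Lc M) (b'.1 : Site (d + 1)) n) (b.2, translate (fine Lc M) (b.1 : Site (d + 1)) m))
            * B l z := by
  -- the per-pair torus member
  set Tm : (↥(pbox (fine Lc M)) × Fin (d + 1)) → (↥(pbox (fine Lc M)) × Fin (d + 1)) → (↥(pbox (fine Lc M)) × Fin (d + 1)) → ℝ := fun b b' q =>
    perF (fine Lc M) (dper (fine Lc M) (fun x z a c => ∑' n : Site (d + 1), (1 / 2 : ℝ) *
      (symVh₂SAt (ctr (d + 1) Lc) Lc b.2 (b.1 : Site (d + 1)) b'.2 (translate (fine Lc M) (b'.1 : Site (d + 1)) n) x z a c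
        + symVh₂SAt (ctr (d + 1) Lc) Lc b'.2 (translate (fine Lc M) (b'.1 : Site (d + 1)) n) b.2 (b.1 : Site (d + 1)) x z a c)))
      (coarsePt M Lc x, Sum.inr κ₀) (q.1, Sum.inl q.2) with hTm
  have hentry : ∀ q : ↥(pbox (fine Lc M)) × Fin (d + 1), stepIns₂₂Sym M Lc w w' (x, κ₀) q
      = ∑ b : ↥(pbox (fine Lc M)) × Fin (d + 1), ∑ b' : ↥(pbox (fine Lc M)) × Fin (d + 1), (w b * w' b') * Tm b b' q := fun q => by
    rw [stepIns₂₂Sym, Matrix.sum_apply]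
    exact Finset.sum_congr rfl fun b _ => by
      rw [Matrix.sum_apply]; exact Finset.sum_congr rfl fun b' _ => by rw [Matrix.smul_apply, Matrix.submatrix_apply, smul_eq_mul]
  calc ∑ q : ↥(pbox (fine Lc M)) × Fin (d + 1), stepIns₂₂Sym M Lc w w' (x, κ₀) q * B q.2 (q.1 : Site (d + 1))
      = ∑ q : ↥(pbox (fine Lc M)) × Fin (d + 1), ∑ b : ↥(pbox (fine Lc M)) × Fin (d + 1), ∑ b' : ↥(pbox (fine Lc M)) × Fin (d + 1),
          (w b * w' b') * (Tm b b' q * B q.2 (q.1 : Site (d + 1))) := by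
        refine Finset.sum_congr rfl fun q _ => ?_
        rw [hentry, Finset.sum_mul]
        refine Finset.sum_congr rfl fun b _ => ?_
        rw [Finset.sum_mul]
        exact Finset.sum_congr rfl fun b' _ => mul_assoc _ _ _
    _ = ∑ b : ↥(pbox (fine Lc M)) × Fin (d + 1), ∑ b' : ↥(pbox (fine Lc M)) × Fin (d + 1), (w b * w' b') *
          ∑ q : ↥(pbox (fine Lc M)) × Fin (d + 1), Tm b b' q * B q.2 (q.1 : Site (d + 1)) := by
        rw [Finset.sum_comm]
        refine Finset.sum_congr rfl fun b _ => ?_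
        rw [Finset.sum_comm]
        exact Finset.sum_congr rfl fun b' _ => (Finset.mul_sum _ _ _).symm
    _ = _ := Finset.sum_congr rfl fun b _ => Finset.sum_congr rfl fun b' _ => by
        rw [Fintype.sum_prod_type]
        exact congrArg (fun t : ℝ => (w b * w' b') * t) (sum_perF_dper_symPair_mul_periodic M Lc hc b.2 (b.1 : Site (d + 1)) b'.2 (b'.1 : Site (d + 1)) B hB x κ₀)

/-- [folklore] **`sum_stepIns₂₂Sym_mul_periodic` — THE (0.4)-SYMMETRISED ONE-STEP SECOND-ORDER BI-JET `stepIns₂₂Sym w w′` ACTS ON `fine Lc M`-PERIODIC 1-FORMS AS an1's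
(0.4)-SYMMETRISED SECOND-ORDER KERNEL AT THE CENTRED ROOT, PAIR-SYMMETRISED, SUMMED AGAINST (THE FORM, THE PERIODIC LIFTS `(κ, u) ↦ w (wrapPt (fine Lc M) u, κ)` OF THE TWO
WEIGHTS)** — the sym twin of R-6's `sum_stepIns₂₂_mul_periodic` (statement VERBATIM under `vh2KerAt (toSite r) ↦ symVh2KerAt (ctr (d+1) Lc)`, `stepIns₂₂ M Lc r ↦ stepIns₂₂Sym M Lc`);
the line R-8's sym pass reads BY NAME. -/
theorem sum_stepIns₂₂Sym_mul_periodic (hc : ctrOff (d + 1) Lc ∈ box (d + 1) Lc) (w w' : ↥(pbox (fine Lc M)) × Fin (d + 1) → ℝ) (B : Form1 (d + 1) ℝ)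
    (hB : ∀ (l : Fin (d + 1)) (y m : Site (d + 1)), B l (translate (fine Lc M) y m) = B l y) (x : ↥(pbox M)) (κ₀ : Fin (d + 1)) :
    ∑ q : ↥(pbox (fine Lc M)) × Fin (d + 1), stepIns₂₂Sym M Lc w w' (x, κ₀) q * B q.2 (q.1 : Site (d + 1))
      = ∑' u : Site (d + 1), ∑ κ : Fin (d + 1), (∑' u' : Site (d + 1), ∑ κ' : Fin (d + 1),
          (∑' z : Site (d + 1), ∑ l : Fin (d + 1),
            (1 / 2 : ℝ) * (symVh2KerAt (ctr (d + 1) Lc) Lc κ₀ (x : Site (d + 1)) (l, z) (κ, u) (κ', u') + symVh2KerAt (ctr (d + 1) Lc) Lc κ₀ (x : Site (d + 1)) (l, z) (κ', u') (κ, u)) * B l z)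
          * w' (wrapPt (fine Lc M) u', κ')) * w (wrapPt (fine Lc M) u, κ) := by
  -- the lattice functional of the ordered pair of background bonds and its finite support in each bond's base
  set G : Bond (d + 1) → Bond (d + 1) → ℝ := fun g g' =>
    ∑' z : Site (d + 1), ∑ l : Fin (d + 1),
      (1 / 2 : ℝ) * (symVh2KerAt (ctr (d + 1) Lc) Lc κ₀ (x : Site (d + 1)) (l, z) g g' + symVh2KerAt (ctr (d + 1) Lc) Lc κ₀ (x : Site (d + 1)) (l, z) g' g) * B l z with hG
  have hG0 : ∀ g g' : Bond (d + 1), g.2 ∉ nearBox Lc (x : Site (d + 1)) ∨ g'.2 ∉ nearBox Lc (x : Site (d + 1)) → G g g' = 0 := fun g g' h =>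
    tsum_symm_symVh2KerAt_mul_eq_zero_of_not_mem Lc hc κ₀ _ h B
  -- the inner lift (second weight), for a fixed first bond
  set H : Fin (d + 1) → Site (d + 1) → ℝ := fun κ u =>
    ∑' u' : Site (d + 1), ∑ κ' : Fin (d + 1), G (κ, u) (κ', u') * w' (wrapPt (fine Lc M) u', κ') with hH
  have hH0 : ∀ (κ : Fin (d + 1)), ∀ u ∉ nearBox Lc (x : Site (d + 1)), H κ u = 0 := fun κ u hu => by
    simp only [hH]
    exact (tsum_congr fun u' => Finset.sum_eq_zero fun κ' _ => by rw [hG0 _ _ (Or.inl hu), zero_mul]).trans tsum_zero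
  have hinner : ∀ (κ : Fin (d + 1)) (u : Site (d + 1)),
      ∑ b' : ↥(pbox (fine Lc M)) × Fin (d + 1), w' b' * ∑' n : Site (d + 1), G (κ, u) (b'.2, translate (fine Lc M) (b'.1 : Site (d + 1)) n) = H κ u :=
    fun κ u => sum_mul_tsum_translate_eq_tsum_lift (fine Lc M) (fun κ' u' => G (κ, u) (κ', u')) (nearBox Lc (x : Site (d + 1)))
      (fun κ' u' hu' => hG0 _ _ (Or.inr hu')) w'
  rw [sum_stepIns₂₂Sym_mul_periodic_eq_sum_bonds M Lc hc w w' B hB x κ₀]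
  -- regroup: first bond outside, its copy sum next, then the second bond and its copies
  have hregroup : ∀ b : ↥(pbox (fine Lc M)) × Fin (d + 1),
      ∑ b' : ↥(pbox (fine Lc M)) × Fin (d + 1), (w b * w' b') *
          ∑' m : Site (d + 1), ∑' n : Site (d + 1), G (b.2, translate (fine Lc M) (b.1 : Site (d + 1)) m) (b'.2, translate (fine Lc M) (b'.1 : Site (d + 1)) n)
        = w b * ∑' m : Site (d + 1), H b.2 (translate (fine Lc M) (b.1 : Site (d + 1)) m) := fun b => by
    -- the copies of the first bond loading the block of `x` are finitely many
    classical
    obtain ⟨Fm, hFm⟩ : ∃ F : Finset (Site (d + 1)), ∀ m ∉ F, translate (fine Lc M) (b.1 : Site (d + 1)) m ∉ nearBox Lc (x : Site (d + 1)) :=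
      ⟨(nearBox Lc (x : Site (d + 1))).preimage (fun m => translate (fine Lc M) (b.1 : Site (d + 1)) m) (translate_injective (one_le_M (fine Lc M)) _).injOn,
        fun m hm hh => hm (Finset.mem_preimage.2 hh)⟩
    have hfin : ∀ b' : ↥(pbox (fine Lc M)) × Fin (d + 1),
        (∑' m : Site (d + 1), ∑' n : Site (d + 1), G (b.2, translate (fine Lc M) (b.1 : Site (d + 1)) m) (b'.2, translate (fine Lc M) (b'.1 : Site (d + 1)) n))
          = ∑ m ∈ Fm, ∑' n : Site (d + 1), G (b.2, translate (fine Lc M) (b.1 : Site (d + 1)) m) (b'.2, translate (fine Lc M) (b'.1 : Site (d + 1)) n) := fun b' =>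
      tsum_eq_sum fun m hm => (tsum_congr fun n => hG0 _ _ (Or.inl (hFm m hm))).trans tsum_zero
    have hfinH : (∑' m : Site (d + 1), H b.2 (translate (fine Lc M) (b.1 : Site (d + 1)) m)) = ∑ m ∈ Fm, H b.2 (translate (fine Lc M) (b.1 : Site (d + 1)) m) :=
      tsum_eq_sum fun m hm => hH0 _ _ (hFm m hm)
    calc ∑ b' : ↥(pbox (fine Lc M)) × Fin (d + 1), (w b * w' b') *
          ∑' m : Site (d + 1), ∑' n : Site (d + 1), G (b.2, translate (fine Lc M) (b.1 : Site (d + 1)) m) (b'.2, translate (fine Lc M) (b'.1 : Site (d + 1)) n)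
        = ∑ b' : ↥(pbox (fine Lc M)) × Fin (d + 1), ∑ m ∈ Fm, w b * (w' b' *
            ∑' n : Site (d + 1), G (b.2, translate (fine Lc M) (b.1 : Site (d + 1)) m) (b'.2, translate (fine Lc M) (b'.1 : Site (d + 1)) n)) := by
          refine Finset.sum_congr rfl fun b' _ => ?_
          rw [hfin b', Finset.mul_sum]
          exact Finset.sum_congr rfl fun m _ => by ring
      _ = ∑ m ∈ Fm, w b * ∑ b' : ↥(pbox (fine Lc M)) × Fin (d + 1), w' b' *
            ∑' n : Site (d + 1), G (b.2, translate (fine Lc M) (b.1 : Site (d + 1)) m) (b'.2, translate (fine Lc M) (b'.1 : Site (d + 1)) n) := by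
          rw [Finset.sum_comm]
          exact Finset.sum_congr rfl fun m _ => (Finset.mul_sum _ _ _).symm
      _ = w b * ∑' m : Site (d + 1), H b.2 (translate (fine Lc M) (b.1 : Site (d + 1)) m) := by
          rw [hfinH, Finset.mul_sum]
          exact Finset.sum_congr rfl fun m _ => by rw [hinner]
  rw [Finset.sum_congr rfl fun b _ => hregroup b]
  -- the outer lift (first weight)
  rw [sum_mul_tsum_translate_eq_tsum_lift (fine Lc M) H (nearBox Lc (x : Site (d + 1))) hH0 w]

end Step

end Summit.QuantumFields.BalabanUV.Beta.FP.TorusStepInsertionSymTwoStep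

end
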